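import Mathlib.Analysis.Calculus.ImplicitContDiff
import Mathlib.Analysis.SpecificLimits.Normed
import Summits.QuantumFields.YangMills.Theorems.BalabanUVNodesN07ChartDOfRecord
import Summits.QuantumFields.YangMills.Theorems.BalabanUVNodesN07ChartLogAnalytic
import HarnessLib

/-!
# K0⁷ STUB 1 (`stub_prop8StepCoP13`), sub-target S4b «the (δ∕δA′)V pieces at objects» — THE CHART BLOCK OF THE SECT. F CAPSTONE AT THE RECORD, part 2:
# **THE TRUE CHART `D(·)` OF (47)–(49) IS ANALYTIC ON THE WEIGHTED BALL** — every solution family of the fixed-point equation (49) obeying the (55) bound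
# (dag-n07-w2's `N07ChartDOfRecord.exists_chartD_of_rightInverse`, `N07ChartDDerivative.exists_chartD_hasFDerivAt`) is `C^ω` on `{A′ | w₁|A′| < ε}`, hence
# `𝔇 := fderiv D` is HOLOMORPHIC there: the capstone's `hD`, `hDdiff` and — with part 1's transposes by formula — `hDtdiff`, at the record's true constraint

Cell `pub-ymgap`, width seat `pub-ymgap-k0-s1-w2` g3 (CLAIM-1 (ii), bus 2026-08-28 04:54Z).  `--kind proof --supports stmt-QuantumFields-20541 --as helper`;
count-neutral.  [15] = [Balaban1985Variational].

WHY.  Prop. 4 p. 292: «The functional derivative of V(A′) is an analytic function on this space»; the capstone `K0Stub1SectFWSlotOneLevel.exists_sectF_W_levOf`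
(p596653) therefore asks, besides `hD : HasFDerivAt D (𝔇 A′) A′`, for the holomorphy `hDdiff` of `D` AND `hDtdiff` of `A′ ↦ 𝔇(A′)ᵗ` on the (115)-ball — a SECOND-order
regularity of the chart `D(·)`.  Print's Prop. 3 says «the transformation (47) … is defined and analytic»; dag-n07-w2's files deliver `D(·)` with (55), (49), (48), a Fréchet
derivative and (73) at norm level (lit-balaban `B11Prop3Model`: implicit function theorem + Neumann series, FIRST order).  THIS FILE supplies the analyticity: at each
point `A′₀` of the ball, Mathlib's implicit function theorem in class `C^ω` (`ContDiffAt.implicitFunction`) for `Φ(A′, X) = X − C(A′ − HX)` — `C = chartLog − Qlin` is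
analytic near `A′₀ − HD(A′₀)` (`N07ChartLogAnalytic.analyticOnNhd_chartLog_weightedBall`), `∂_XΦ = 1 + 𝒞′(A′₀ − HD(A′₀))H` is invertible because
`‖𝒞′(·)H‖ ≤ 4C₂B₀ε(1 + 4C₂B₀ε) < 1` ((72) `norm_fderiv_chartLog_sub_fderiv_zero_le_weightedBall` + (46) + (57) `size_chartA_le`; (69) «‖ℜ‖ ≤ 9C₂B₀ε₃») — and the
implicit function coincides with the given solution family near `A′₀` by dag-n07-w2's UNIQUENESS clause and the continuity of the implicit function.

WHAT IS PROVED (sorry-free; no definition; axioms standard; fibre `M_n(ℂ)`, any finite non-empty `n`; generic carrier `P : Params`).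
* §1 `exists_size_lt` (a point of the open weighted ball has a size `ρ₀ < ε`), `isOpen_weightedBall`, `chartD_unique` (two small solutions of (49) at the same `A′`
  coincide — from `exists_chartD_of_rightInverse` (ii)), `window_of_h18` (the `ε`-window `18C₂B₀ε ≤ 1`, `64ε ≤ R⋆` implies §1's `9C₂B₀ε < 1`, `3ε ≤ R⋆∕4`).
* §2 ★★★ `contDiffAt_chartD` ∕ `contDiffOn_chartD` ∕ `analyticOnNhd_chartD` — for every torus `P`, height `k`, admissible nested family (`Adm22 D R′ M`, `2L ≤ R′`,
  `1 ≤ M`, `D.k = k`), weights `IsLevWeight P k D w`, ℂ-linear right inverse `H` of `Qlin = D(chartLog η D)(0)` with the weighted (46) letter `B₀` (displayed, dag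
  k0-s1-w1's), `ε > 0` with `18C₂B₀ε ≤ 1`, `64ε ≤ R⋆`, and EVERY map `Dfun` satisfying on the ball `{A′ | ∀ b, w 1 b·‖A′ b‖ < ε}` the (55) family
  `‖Dfun A′ i‖ ≤ 4C₂ρ²` (all size bounds `ρ`) and (49) `C(A′ − H·Dfun A′) = Dfun A′`: `ContDiffOn ℂ ω Dfun` on the ball (⇔ analytic at each of its points);
  `hasFDerivAt_chartD` (`HasFDerivAt Dfun (fderiv ℂ Dfun A′) A′` on the ball — the capstone's `hD` with `𝔇 := fderiv ℂ Dfun`), ★★ `differentiableOn_fderiv_chartD`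
  (`DifferentiableOn ℂ (fderiv ℂ Dfun)` on the ball — the regularity behind `hDtdiff`).
* §3 ★★ `exists_analytic_chartD_of_rightInverse` — the selector edition: under the same binders `∃ Dfun`, `C^ω` on the ball, with (55), (49), (48) at every point
  (dag-n07-w2's `exists_chartD_of_rightInverse` pointwise + §2); by `chartD_unique` it agrees on the ball with every other solution family, in particular with
  `N07ChartDDerivative.exists_chartD_hasFDerivAt`'s `Dfun` (which carries the (73) letter).
HONEST SCOPE.  Mathlib's implicit function theorem + dag-n07-w2's landed theorems BY NAME; `H` displayed; no new estimate ((73)'s kernel decay, (58) NOT here); nothing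
of [15] Sects. D–F asserted; `stub_prop8StepCoP13` ∕ K0⁷ NOT closed; N07 NOT discharged; counts unmoved (28∕28 · 5∕27); one finite 𝕋⁴ programme at fixed ε — R4 closes
the conditional finite-𝕋⁴ rung `BalabanLadder.UV` only, never the summit; the YM mass gap (Clay) is NOT proved by any of this; nothing continuum ∕ ℝ⁴ ∕ OS.
No `sorry`, no `def`, no `instance`, no `notation`.

References: [15] (43)–(50) p.285, (54)–(55) p.286, (57) p.286, (63)–(73) pp.287–289, Prop. 3 p.289, Prop. 4 p.292, (157) p.302.
-/

noncomputable section

open scoped BigOperators Matrix.Norms.L2Operator Topology ContDiff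
open NormedSpace Metric Set Filter

namespace Summit.QuantumFields.YangMills.Theorems.K0Stub1ChartDAnalytic

open Literature.MathematicalPhysics.QuantumFieldTheory.Balaban1983to89
open Literature.MathematicalPhysics.QuantumFieldTheory.Balaban1983to89.B6SectADomainsV1 (Domains)
open Literature.MathematicalPhysics.QuantumFieldTheory.Balaban1983to89.B6SectAOperatorsV1 (BondIdx)
open Summit.QuantumFields.YangMills.Theorems.FlatCubeOpsText (Adm22)
open Summit.QuantumFields.YangMills.Theorems.K0FlatCubeOpsTextP (IsLevWeight)
open Summit.QuantumFields.YangMills.Theorems.Prop8Chart (chartLog collar_of_adm22)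
open Summit.QuantumFields.YangMills.BalabanUVNodes.N07ChartDOfRecord (exists_chartD_of_rightInverse size_chartA_le)
open Summit.QuantumFields.YangMills.BalabanUVNodes.N07ChartLogAnalytic (analyticOnNhd_chartLog_weightedBall
  norm_fderiv_chartLog_sub_fderiv_zero_le_weightedBall)

variable {P : Params} {n : Type*} [Fintype n] [DecidableEq n] [Nonempty n]

/-! ## §1  Bookkeeping: sizes in the open weighted ball, openness, uniqueness of small solutions of (49), the `ε`-window -/

omit [Nonempty n] in
/-- A point of the OPEN weighted ball has a non-negative size strictly below the radius (finitely many bonds). [folklore] -/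
theorem exists_size_lt {w : ℕ → PBond P 0 → ℝ} (hwpos : ∀ b, 0 < w 1 b) {ε : ℝ} (hε : 0 < ε)
    (A : PBond P 0 → Matrix n n ℂ) (hA : ∀ b, w 1 b * ‖A b‖ < ε) :
    ∃ ρ₀ : ℝ, 0 ≤ ρ₀ ∧ ρ₀ < ε ∧ ∀ b, w 1 b * ‖A b‖ ≤ ρ₀ := by
  classical
  rcases isEmpty_or_nonempty (PBond P 0) with hE | hNE
  · exact ⟨0, le_rfl, hε, fun b => hE.elim b⟩
  · obtain ⟨b₀, -, hmax⟩ := Finset.exists_max_image Finset.univ (fun b : PBond P 0 => w 1 b * ‖A b‖) Finset.univ_nonempty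
    exact ⟨w 1 b₀ * ‖A b₀‖, mul_nonneg (hwpos b₀).le (norm_nonneg _), hA b₀, fun b => hmax b (Finset.mem_univ b)⟩

omit [Nonempty n] in
/-- The weighted ball `{Y | ∀ b, w 1 b·‖Y b‖ < ε}` is open. [folklore] -/
theorem isOpen_weightedBall (w : ℕ → PBond P 0 → ℝ) (ε : ℝ) :
    IsOpen {Y : PBond P 0 → Matrix n n ℂ | ∀ b, w 1 b * ‖Y b‖ < ε} := by
  rw [Set.setOf_forall]
  exact isOpen_iInter_of_finite fun b =>
    isOpen_lt ((continuous_const.mul (continuous_apply b).norm)) continuous_const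

omit [Nonempty n] in
/-- The box `{X | ∀ i, ‖X i‖ < R}` of block data is open. [folklore] -/
theorem isOpen_blockBox {ι : Type*} [Fintype ι] (R : ℝ) : IsOpen {X : ι → Matrix n n ℂ | ∀ i, ‖X i‖ < R} := by
  rw [Set.setOf_forall]
  exact isOpen_iInter_of_finite fun i => isOpen_lt (continuous_apply i).norm continuous_const

/-- **THE `ε`-WINDOW OF `N07ChartDDerivative` IMPLIES THE ONE OF `N07ChartDOfRecord`**: `18C₂B₀ε ≤ 1`, `64ε ≤ R⋆`, `ε > 0`, `C₂, B₀ ≥ 0` give `9C₂B₀ε < 1` and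
`3ε ≤ R⋆∕4`. [cite: Balaban1985Variational, (54) p.286, Prop. 3 p.289 (bookkeeping)] -/
theorem window_of_h18 {C₂ B₀ ε Rs : ℝ} (hC₂ : 0 ≤ C₂) (hB₀ : 0 ≤ B₀) (hε : 0 < ε) (h18 : 18 * C₂ * B₀ * ε ≤ 1) (h2 : 64 * ε ≤ Rs) :
    9 * C₂ * B₀ * ε < 1 ∧ 3 * ε ≤ Rs / 4 := by
  have h0 : 0 ≤ C₂ * B₀ * ε := mul_nonneg (mul_nonneg hC₂ hB₀) hε.le
  constructor
  · linarith
  · linarith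

/-- **UNIQUENESS OF SMALL SOLUTIONS OF (49) AT A POINT** (from dag-n07-w2's `exists_chartD_of_rightInverse` (ii)): under the §1 data of that theorem, at every `A′` of the
weighted `ε`-ball two `D′` with `‖D′ i‖ ≤ 4C₂ε²` and `C(A′ − HD′) = D′` coincide. [cite: Balaban1985Variational, (49)-(54) pp.285-286, Prop. 3 p.289] -/
theorem chartD_unique (k : ℕ) {R' M : ℕ} (hR'L : 2 * P.L ≤ R') (hM : 1 ≤ M) (D : Domains P) (hDk : D.k = k) (hAdm : Adm22 D R' M)
    {w : ℕ → PBond P 0 → ℝ} (hw : IsLevWeight P k D w)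
    (H : (BondIdx D → Matrix n n ℂ) →ₗ[ℂ] (PBond P 0 → Matrix n n ℂ))
    (hHinv : ∀ X, (fderiv ℂ (chartLog (((P.L : ℝ)⁻¹) ^ k) D : (PBond P 0 → Matrix n n ℂ) → BondIdx D → Matrix n n ℂ) 0) (H X) = X)
    {B₀ : ℝ} (hB₀ : 0 ≤ B₀)
    (hHB : ∀ (X : BondIdx D → Matrix n n ℂ) (t : ℝ), 0 ≤ t → (∀ i, ‖X i‖ ≤ t) → ∀ b, w 1 b * ‖H X b‖ ≤ B₀ * t)
    {ε : ℝ} (hε : 0 < ε)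
    (hq : 9 * (960 * (((P.d + 2) * P.L : ℕ) : ℝ) * (P.L : ℝ) / (12800 * (((P.d + 2) * P.L : ℕ) : ℝ) ^ 2 * (P.L : ℝ))⁻¹) * B₀ * ε < 1)
    (h3 : 3 * ε ≤ (12800 * (((P.d + 2) * P.L : ℕ) : ℝ) ^ 2 * (P.L : ℝ))⁻¹ / 4)
    (A' : PBond P 0 → Matrix n n ℂ) (hA' : ∀ b, w 1 b * ‖A' b‖ < ε)
    (D₁ D₂ : BondIdx D → Matrix n n ℂ)
    (hD₁ : ∀ i, ‖D₁ i‖ ≤ 4 * (960 * (((P.d + 2) * P.L : ℕ) : ℝ) * (P.L : ℝ) / (12800 * (((P.d + 2) * P.L : ℕ) : ℝ) ^ 2 * (P.L : ℝ))⁻¹) * ε ^ 2)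
    (hfix₁ : chartLog (((P.L : ℝ)⁻¹) ^ k) D (A' - H D₁) -
      (fderiv ℂ (chartLog (((P.L : ℝ)⁻¹) ^ k) D : (PBond P 0 → Matrix n n ℂ) → BondIdx D → Matrix n n ℂ) 0) (A' - H D₁) = D₁)
    (hD₂ : ∀ i, ‖D₂ i‖ ≤ 4 * (960 * (((P.d + 2) * P.L : ℕ) : ℝ) * (P.L : ℝ) / (12800 * (((P.d + 2) * P.L : ℕ) : ℝ) ^ 2 * (P.L : ℝ))⁻¹) * ε ^ 2)
    (hfix₂ : chartLog (((P.L : ℝ)⁻¹) ^ k) D (A' - H D₂) -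
      (fderiv ℂ (chartLog (((P.L : ℝ)⁻¹) ^ k) D : (PBond P 0 → Matrix n n ℂ) → BondIdx D → Matrix n n ℂ) 0) (A' - H D₂) = D₂) :
    D₁ = D₂ := by
  obtain ⟨Dv, -, huniq, -, -⟩ := exists_chartD_of_rightInverse (n := n) k hR'L hM D hDk hAdm hw H hHinv hB₀ hHB hε hq h3 A' hA'
  rw [huniq D₁ hD₁ hfix₁, huniq D₂ hD₂ hfix₂]

/-! ## §2  ★★★ Every solution family of (49) with the (55) bound is `C^ω` on the weighted ball -/

section Solution

/-! The common binders of §2: torus, height, admissible family, weights, right inverse `H` with the (46) letter, the `ε`-window, and a solution family `Dfun` of (49)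
with the (55) bound on the sup-ball (all explicit hypotheses of every theorem of this section, in this order). -/
variable (k : ℕ) {R' M : ℕ} (hR'L : 2 * P.L ≤ R') (hM : 1 ≤ M) (D : Domains P) (hDk : D.k = k) (hAdm : Adm22 D R' M)
    {w : ℕ → PBond P 0 → ℝ} (hw : IsLevWeight P k D w)
    (H : (BondIdx D → Matrix n n ℂ) →ₗ[ℂ] (PBond P 0 → Matrix n n ℂ))
    (hHinv : ∀ X, (fderiv ℂ (chartLog (((P.L : ℝ)⁻¹) ^ k) D : (PBond P 0 → Matrix n n ℂ) → BondIdx D → Matrix n n ℂ) 0) (H X) = X)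
    {B₀ : ℝ} (hB₀ : 0 ≤ B₀)
    (hHB : ∀ (X : BondIdx D → Matrix n n ℂ) (t : ℝ), 0 ≤ t → (∀ i, ‖X i‖ ≤ t) → ∀ b, w 1 b * ‖H X b‖ ≤ B₀ * t)
    {ε : ℝ} (hε : 0 < ε)
    (h18 : 18 * (960 * (((P.d + 2) * P.L : ℕ) : ℝ) * (P.L : ℝ) / (12800 * (((P.d + 2) * P.L : ℕ) : ℝ) ^ 2 * (P.L : ℝ))⁻¹) * B₀ * ε ≤ 1)
    (h2 : 64 * ε ≤ (12800 * (((P.d + 2) * P.L : ℕ) : ℝ) ^ 2 * (P.L : ℝ))⁻¹)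
    (Dfun : (PBond P 0 → Matrix n n ℂ) → (BondIdx D → Matrix n n ℂ))
    (h55 : ∀ A' : PBond P 0 → Matrix n n ℂ, (∀ b, w 1 b * ‖A' b‖ < ε) →
      ∀ ρ : ℝ, 0 ≤ ρ → (∀ b, w 1 b * ‖A' b‖ ≤ ρ) →
        ∀ i, ‖Dfun A' i‖ ≤ 4 * (960 * (((P.d + 2) * P.L : ℕ) : ℝ) * (P.L : ℝ) / (12800 * (((P.d + 2) * P.L : ℕ) : ℝ) ^ 2 * (P.L : ℝ))⁻¹) * ρ ^ 2)
    (h49 : ∀ A' : PBond P 0 → Matrix n n ℂ, (∀ b, w 1 b * ‖A' b‖ < ε) →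
      chartLog (((P.L : ℝ)⁻¹) ^ k) D (A' - H (Dfun A')) -
        (fderiv ℂ (chartLog (((P.L : ℝ)⁻¹) ^ k) D : (PBond P 0 → Matrix n n ℂ) → BondIdx D → Matrix n n ℂ) 0) (A' - H (Dfun A')) = Dfun A')

include hR'L hM hDk hAdm hw hHinv hB₀ hHB hε h18 h2 h55 h49

/-- ★★★ **THE TRUE CHART `D(·)` IS ANALYTIC AT EVERY POINT OF THE WEIGHTED BALL.**  Data: torus `P`, height `k`, admissible nested family `D` (`Adm22 D R′ M`,
`2L ≤ R′`, `1 ≤ M`, `D.k = k`), weights `IsLevWeight P k D w`, a ℂ-linear right inverse `H` of `Qlin = D(chartLog η D)(0)` (`η = L^{−k}`) with the weighted (46) letter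
`B₀` (displayed), `ε > 0` with `18C₂B₀ε ≤ 1` and `64ε ≤ R⋆` (`R⋆ = 1∕(12800ℓ²L)`, `C₂ = 960ℓL∕R⋆`, `ℓ = (d+2)L`); and ANY map `Dfun` which, at every `A′` of the
ball `{∀ b, w 1 b·‖A′ b‖ < ε}`, obeys (55) `‖Dfun A′ i‖ ≤ 4C₂ρ²` for all size bounds `ρ ≥ 0` of `A′` and (49) `C(A′ − H·Dfun A′) = Dfun A′`, `C = chartLog η D − Qlin`.
THEN `Dfun` is `C^ω` at every point `A₀` of the ball.  Proof: the implicit function theorem in class `ω` for `Φ(A′, X) = X − C(A′ − HX)` at `(A₀, Dfun A₀)` —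
`C` analytic there (weighted size of `A₀ − H·Dfun A₀` `≤ ε + 4B₀C₂ε² < R⋆`), `∂_XΦ = 1 + 𝒞′H` with `‖𝒞′H‖ ≤ 4C₂B₀ε(1 + 4C₂B₀ε) < 1` by (72) and (46) — and
identification of the implicit function with `Dfun` near `A₀` by uniqueness of small solutions ((ii) of `exists_chartD_of_rightInverse`) and continuity.
[cite: Balaban1985Variational, (47)-(55) pp.285-286, (69)-(73) p.289, Prop. 3 p.289, Prop. 4 p.292] -/
theorem contDiffAt_chartD (A₀ : PBond P 0 → Matrix n n ℂ) (hA₀ : ∀ b, w 1 b * ‖A₀ b‖ < ε) : ContDiffAt ℂ ω Dfun A₀ := by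
  -- letters
  set η : ℝ := ((P.L : ℝ)⁻¹) ^ k with hη
  set Rs : ℝ := (12800 * (((P.d + 2) * P.L : ℕ) : ℝ) ^ 2 * (P.L : ℝ))⁻¹ with hRs
  set C₂ : ℝ := 960 * (((P.d + 2) * P.L : ℕ) : ℝ) * (P.L : ℝ) / Rs with hC₂def
  set Qlin : (PBond P 0 → Matrix n n ℂ) →L[ℂ] (BondIdx D → Matrix n n ℂ) :=
    (fderiv ℂ (chartLog η D : (PBond P 0 → Matrix n n ℂ) → BondIdx D → Matrix n n ℂ) 0) with hQlin
  have hL0 : (0 : ℝ) < P.L := by exact_mod_cast P.L_pos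
  have hℓ1 : (1 : ℝ) ≤ (((P.d + 2) * P.L : ℕ) : ℝ) := by
    exact_mod_cast Nat.one_le_iff_ne_zero.mpr (Nat.mul_ne_zero (by omega) (by have := P.hL.2; omega))
  have hden : 0 < 12800 * (((P.d + 2) * P.L : ℕ) : ℝ) ^ 2 * (P.L : ℝ) := by positivity
  have hRs0 : 0 < Rs := inv_pos.mpr hden
  have hRs1 : 12800 * (((P.d + 2) * P.L : ℕ) : ℝ) ^ 2 * (P.L : ℝ) * Rs ≤ 1 := by
    rw [hRs, mul_inv_cancel₀ hden.ne']
  have hC₂0 : 0 < C₂ := by rw [hC₂def]; positivity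
  have hC₂ : 0 ≤ C₂ := hC₂0.le
  have hwpos : ∀ b, 0 < w 1 b := fun b => by rw [hw 1 b, pow_one]; positivity
  have hRM : 2 * P.L ≤ R' * M + 1 := by have : R' ≤ R' * M := Nat.le_mul_of_pos_right R' hM; omega
  have hcollar := collar_of_adm22 D hAdm hRM
  obtain ⟨hq, h3⟩ := window_of_h18 hC₂ hB₀ hε h18 h2
  have hx : C₂ * B₀ * ε ≤ 1 / 18 := by nlinarith [mul_nonneg (mul_nonneg hC₂ hB₀) hε.le]
  -- the carriers
  haveI : CompleteSpace (PBond P 0 → Matrix n n ℂ) := FiniteDimensional.complete ℂ _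
  haveI : CompleteSpace (BondIdx D → Matrix n n ℂ) := FiniteDimensional.complete ℂ _
  let Hc : (BondIdx D → Matrix n n ℂ) →L[ℂ] (PBond P 0 → Matrix n n ℂ) := LinearMap.toContinuousLinearMap H
  have hHc : ∀ X, Hc X = H X := fun _ => rfl
  -- the nonlinear part `C` and the implicit equation `Φ`
  set C : (PBond P 0 → Matrix n n ℂ) → (BondIdx D → Matrix n n ℂ) := fun Y => chartLog η D Y - Qlin Y with hC
  let g : (PBond P 0 → Matrix n n ℂ) × (BondIdx D → Matrix n n ℂ) →L[ℂ] (PBond P 0 → Matrix n n ℂ) :=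
    ContinuousLinearMap.fst ℂ _ _ - Hc.comp (ContinuousLinearMap.snd ℂ _ _)
  have hg : ∀ p : (PBond P 0 → Matrix n n ℂ) × (BondIdx D → Matrix n n ℂ), g p = p.1 - H p.2 := fun _ => rfl
  set Φ : (PBond P 0 → Matrix n n ℂ) × (BondIdx D → Matrix n n ℂ) → (BondIdx D → Matrix n n ℂ) := fun p => p.2 - C (g p) with hΦ
  -- the base point: size `ρ₀ < ε`, `X₀ = Dfun A₀`, `T₀ = A₀ − H X₀`
  obtain ⟨ρ₀, hρ₀0, hρ₀ε, hA₀ρ⟩ := exists_size_lt hwpos hε A₀ hA₀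
  set X₀ := Dfun A₀ with hX₀
  have hX₀ρ : ∀ i, ‖X₀ i‖ ≤ 4 * C₂ * ρ₀ ^ 2 := h55 A₀ hA₀ ρ₀ hρ₀0 hA₀ρ
  have hX₀lt : ∀ i, ‖X₀ i‖ < 4 * C₂ * ε ^ 2 := fun i =>
    (hX₀ρ i).trans_lt (by
      have : ρ₀ ^ 2 < ε ^ 2 := by nlinarith
      nlinarith)
  set T₀ : PBond P 0 → Matrix n n ℂ := A₀ - H X₀ with hT₀
  -- (57): the size of `T₀`
  set r₀ : ℝ := ρ₀ + B₀ * (4 * C₂ * ρ₀ ^ 2) with hr₀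
  have hr₀0 : 0 ≤ r₀ := by positivity
  have hT₀r : ∀ b, w 1 b * ‖T₀ b‖ ≤ r₀ := size_chartA_le hwpos H hC₂ hB₀ hHB hA₀ρ hX₀ρ
  have hr₀ε : r₀ ≤ ε + B₀ * (4 * C₂ * ε ^ 2) := by
    have h1 : ρ₀ ^ 2 ≤ ε ^ 2 := pow_le_pow_left₀ hρ₀0 hρ₀ε.le 2
    have : B₀ * (4 * C₂ * ρ₀ ^ 2) ≤ B₀ * (4 * C₂ * ε ^ 2) := by gcongr
    linarith
  have hr₀2 : r₀ < 2 * ε := by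
    have : B₀ * (4 * C₂ * ε ^ 2) = 4 * (C₂ * B₀ * ε) * ε := by ring
    nlinarith
  have h8r₀ : 8 * r₀ ≤ Rs := by linarith
  have hT₀Rs : ∀ b, w 1 b * ‖T₀ b‖ < Rs := fun b => (hT₀r b).trans_lt (by linarith)
  -- `C` is analytic at `T₀`, hence `Φ` is `C^ω` at `(A₀, X₀)`
  have han : AnalyticAt ℂ (chartLog η D : (PBond P 0 → Matrix n n ℂ) → BondIdx D → Matrix n n ℂ) T₀ :=
    analyticOnNhd_chartLog_weightedBall (𝔸 := Matrix n n ℂ) k D hDk hcollar hw hRs1 T₀ hT₀Rs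
  have hCan : AnalyticAt ℂ C T₀ := han.sub (Qlin.analyticAt T₀)
  have hg0 : g (A₀, X₀) = T₀ := rfl
  have hΦcd : ContDiffAt ℂ ω Φ (A₀, X₀) := by
    have h1 : ContDiffAt ℂ ω (fun p : (PBond P 0 → Matrix n n ℂ) × (BondIdx D → Matrix n n ℂ) => C (g p)) (A₀, X₀) :=
      (hg0 ▸ hCan.contDiffAt).comp (A₀, X₀) g.contDiff.contDiffAt
    exact contDiffAt_snd.sub h1
  -- the derivative of `Φ` in the second variable: `1 + 𝒞′(T₀) H`
  set Cp : (PBond P 0 → Matrix n n ℂ) →L[ℂ] (BondIdx D → Matrix n n ℂ) := fderiv ℂ C T₀ with hCp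
  have hCderiv : HasFDerivAt C Cp T₀ := hCan.differentiableAt.hasFDerivAt
  have hCp_eq : Cp = fderiv ℂ (chartLog η D : (PBond P 0 → Matrix n n ℂ) → BondIdx D → Matrix n n ℂ) T₀ - Qlin :=
    (han.differentiableAt.hasFDerivAt.sub Qlin.hasFDerivAt).fderiv
  have hΦderiv : HasFDerivAt Φ (ContinuousLinearMap.snd ℂ _ _ - Cp.comp g) (A₀, X₀) := by
    have h1 : HasFDerivAt (fun p : (PBond P 0 → Matrix n n ℂ) × (BondIdx D → Matrix n n ℂ) => C (g p)) (Cp.comp g) (A₀, X₀) :=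
      (hg0 ▸ hCderiv).comp (A₀, X₀) g.hasFDerivAt
    exact hasFDerivAt_snd.sub h1
  set K : (BondIdx D → Matrix n n ℂ) →L[ℂ] (BondIdx D → Matrix n n ℂ) := Cp.comp Hc with hK
  have hinr : fderiv ℂ Φ (A₀, X₀) ∘L ContinuousLinearMap.inr ℂ (PBond P 0 → Matrix n n ℂ) (BondIdx D → Matrix n n ℂ) = 1 + K := by
    rw [hΦderiv.fderiv]
    ext1 X
    rw [ContinuousLinearMap.comp_apply, ContinuousLinearMap.inr_apply]
    show X - Cp (g (0, X)) = X + K X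
    rw [hg, hK, ContinuousLinearMap.comp_apply, hHc]
    show X - Cp ((0 : PBond P 0 → Matrix n n ℂ) - H X) = X + Cp (H X)
    rw [zero_sub, map_neg, sub_neg_eq_add]
  -- (69): `‖K‖ ≤ 4C₂B₀ε(1 + 4C₂B₀ε) < 1`
  have hc0 : 0 ≤ 3840 * (((P.d + 2) * P.L : ℕ) : ℝ) * (P.L : ℝ) / Rs * B₀ * r₀ :=
    mul_nonneg (mul_nonneg (div_nonneg (by positivity) hRs0.le) hB₀) hr₀0
  have hKbd : ∀ X : BondIdx D → Matrix n n ℂ, ‖K X‖ ≤ 3840 * (((P.d + 2) * P.L : ℕ) : ℝ) * (P.L : ℝ) / Rs * B₀ * r₀ * ‖X‖ := by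
    intro X
    have hHX : ∀ b, w 1 b * ‖H X b‖ ≤ B₀ * ‖X‖ := hHB X ‖X‖ (norm_nonneg _) (fun i => norm_le_pi_norm X i)
    refine (pi_norm_le_iff_of_nonneg (mul_nonneg hc0 (norm_nonneg X))).2 fun i => ?_
    have happ : K X i = (fderiv ℂ (chartLog η D : (PBond P 0 → Matrix n n ℂ) → BondIdx D → Matrix n n ℂ) T₀) (H X) i -
        (fderiv ℂ (chartLog η D : (PBond P 0 → Matrix n n ℂ) → BondIdx D → Matrix n n ℂ) 0) (H X) i := by
      rw [hK, ContinuousLinearMap.comp_apply, hHc, hCp_eq]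
      rfl
    rw [happ]
    have h72 := norm_fderiv_chartLog_sub_fderiv_zero_le_weightedBall (𝔸 := Matrix n n ℂ) k D hDk hcollar hw hRs1 hRs0 T₀ (H X)
      hr₀0 h8r₀ (mul_nonneg hB₀ (norm_nonneg X)) hT₀r hHX i
    calc _ ≤ 3840 * (((P.d + 2) * P.L : ℕ) : ℝ) * (P.L : ℝ) / Rs * (B₀ * ‖X‖) * r₀ := h72
      _ = _ := by ring
  have hq₀ : 3840 * (((P.d + 2) * P.L : ℕ) : ℝ) * (P.L : ℝ) / Rs * B₀ * r₀ < 1 := by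
    have hC₃ : 3840 * (((P.d + 2) * P.L : ℕ) : ℝ) * (P.L : ℝ) / Rs = 4 * C₂ := by rw [hC₂def]; ring
    rw [hC₃]
    have h1 : 4 * C₂ * B₀ * r₀ ≤ 4 * (C₂ * B₀ * ε) + 16 * (C₂ * B₀ * ε) ^ 2 := by
      have : 4 * C₂ * B₀ * (ε + B₀ * (4 * C₂ * ε ^ 2)) = 4 * (C₂ * B₀ * ε) + 16 * (C₂ * B₀ * ε) ^ 2 := by ring
      rw [← this]
      exact mul_le_mul_of_nonneg_left hr₀ε (by positivity)
    have h0 : 0 ≤ C₂ * B₀ * ε := mul_nonneg (mul_nonneg hC₂ hB₀) hε.le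
    have hx2 : (C₂ * B₀ * ε) ^ 2 ≤ (1 / 18) ^ 2 := pow_le_pow_left₀ h0 hx 2
    linarith
  have hKnorm : ‖K‖ < 1 :=
    lt_of_le_of_lt (ContinuousLinearMap.opNorm_le_bound K hc0 hKbd) hq₀
  have hinv : (fderiv ℂ Φ (A₀, X₀) ∘L ContinuousLinearMap.inr ℂ (PBond P 0 → Matrix n n ℂ) (BondIdx D → Matrix n n ℂ)).IsInvertible := by
    rw [hinr]
    have hKn : ‖-K‖ < 1 := (norm_neg K).trans_lt hKnorm
    refine ⟨ContinuousLinearEquiv.unitsEquiv ℂ _ (Units.oneSub (-K) hKn), ?_⟩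
    ext1 X
    rw [ContinuousLinearEquiv.coe_coe, ContinuousLinearEquiv.unitsEquiv_apply, Units.val_oneSub, sub_neg_eq_add]
  -- the implicit function and its identification with `Dfun`
  have hω : (ω : ℕ∞ω) ≠ 0 := by simp
  have hψc : ContDiffAt ℂ ω (hΦcd.implicitFunction hω hinv) A₀ := hΦcd.contDiffAt_implicitFunction hω hinv
  have hψ0 : hΦcd.implicitFunction hω hinv A₀ = X₀ := hΦcd.implicitFunction_apply_self hω hinv
  have hev := hΦcd.eventually_apply_eq_iff_implicitFunction hω hinv
  have hΦ0 : Φ (A₀, X₀) = 0 := by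
    show X₀ - C (g (A₀, X₀)) = 0
    rw [hg0]
    have := h49 A₀ hA₀
    rw [sub_eq_zero]
    exact this.symm
  have hψcont : ContinuousAt (hΦcd.implicitFunction hω hinv) A₀ := hψc.continuousAt
  have htend : Tendsto (fun A => (A, hΦcd.implicitFunction hω hinv A)) (𝓝 A₀) (𝓝 (A₀, X₀)) := by
    have h := (continuous_id.continuousAt (x := A₀)).prodMk hψcont
    rwa [ContinuousAt, id, hψ0] at h
  -- near `A₀`: in the ball, the implicit function is small, and solves (49)
  have hball : ∀ᶠ A in 𝓝 A₀, ∀ b, w 1 b * ‖A b‖ < ε := (isOpen_weightedBall w ε).mem_nhds hA₀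
  have hsmall : ∀ᶠ A in 𝓝 A₀, ∀ i, ‖hΦcd.implicitFunction hω hinv A i‖ < 4 * C₂ * ε ^ 2 := by
    have hmem : {X : BondIdx D → Matrix n n ℂ | ∀ i, ‖X i‖ < 4 * C₂ * ε ^ 2} ∈ 𝓝 (hΦcd.implicitFunction hω hinv A₀) := by
      rw [hψ0]; exact (isOpen_blockBox _).mem_nhds hX₀lt
    exact hψcont.preimage_mem_nhds hmem
  have hsol : ∀ᶠ A in 𝓝 A₀, Φ (A, hΦcd.implicitFunction hω hinv A) = 0 := by
    filter_upwards [htend.eventually hev] with A hA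
    rw [← hΦ0]
    exact hA.mpr rfl
  have heq : Dfun =ᶠ[𝓝 A₀] hΦcd.implicitFunction hω hinv := by
    filter_upwards [hball, hsmall, hsol] with A hA hAs hAsol
    have hfixψ : chartLog η D (A - H (hΦcd.implicitFunction hω hinv A)) - Qlin (A - H (hΦcd.implicitFunction hω hinv A)) =
        hΦcd.implicitFunction hω hinv A := by
      have h : hΦcd.implicitFunction hω hinv A - C (A - H (hΦcd.implicitFunction hω hinv A)) = 0 := by
        have h' := hAsol
        simp only [hΦ, hg] at h'
        exact h'
      exact (sub_eq_zero.mp h).symm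
    exact chartD_unique k hR'L hM D hDk hAdm hw H hHinv hB₀ hHB hε hq h3 A hA _ _
      (h55 A hA ε hε.le (fun b => (hA b).le)) (h49 A hA) (fun i => (hAs i).le) hfixψ
  exact hψc.congr_of_eventuallyEq heq

/-- ★★★ **`ContDiffOn ℂ ω` ON THE WHOLE BALL** (same binders). [cite: Balaban1985Variational, Prop. 3 p.289, Prop. 4 p.292] -/
theorem contDiffOn_chartD :
    ContDiffOn ℂ ω Dfun {Y : PBond P 0 → Matrix n n ℂ | ∀ b, w 1 b * ‖Y b‖ < ε} := fun A hA =>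
  (contDiffAt_chartD k hR'L hM D hDk hAdm hw H hHinv hB₀ hHB hε h18 h2 Dfun h55 h49 A hA).contDiffWithinAt

/-- **ANALYTIC ON A NEIGHBOURHOOD OF EVERY POINT OF THE BALL** (`AnalyticOnNhd`) — print's word «analytic». [cite: Balaban1985Variational, Prop. 3 p.289] -/
theorem analyticOnNhd_chartD :
    AnalyticOnNhd ℂ Dfun {Y : PBond P 0 → Matrix n n ℂ | ∀ b, w 1 b * ‖Y b‖ < ε} := fun A hA =>
  (contDiffAt_chartD k hR'L hM D hDk hAdm hw H hHinv hB₀ hHB hε h18 h2 Dfun h55 h49 A hA).analyticAt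

/-- **THE CAPSTONE's `hD` WITH `𝔇 := fderiv ℂ Dfun`**: on the ball, `HasFDerivAt Dfun (fderiv ℂ Dfun A′) A′`. [cite: Balaban1985Variational, (63)-(73) pp.287-289] -/
theorem hasFDerivAt_chartD (A' : PBond P 0 → Matrix n n ℂ) (hA' : ∀ b, w 1 b * ‖A' b‖ < ε) :
    HasFDerivAt Dfun (fderiv ℂ Dfun A') A' :=
  ((contDiffAt_chartD k hR'L hM D hDk hAdm hw H hHinv hB₀ hHB hε h18 h2 Dfun h55 h49 A' hA').differentiableAt (by simp)).hasFDerivAt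

/-- ★★ **THE REGULARITY BEHIND `hDtdiff`: `𝔇 := fderiv ℂ Dfun` IS HOLOMORPHIC ON THE BALL** — `DifferentiableOn ℂ (fderiv ℂ Dfun)` there (open set,
`contDiffOn_succ_iff_fderiv_of_isOpen`). [cite: Balaban1985Variational, Prop. 3 p.289, Prop. 4 p.292 («The functional derivative of V(A′) is an analytic function»)] -/
theorem differentiableOn_fderiv_chartD :
    DifferentiableOn ℂ (fderiv ℂ Dfun) {Y : PBond P 0 → Matrix n n ℂ | ∀ b, w 1 b * ‖Y b‖ < ε} := by
  have h := contDiffOn_chartD k hR'L hM D hDk hAdm hw H hHinv hB₀ hHB hε h18 h2 Dfun h55 h49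
  have h2' : ContDiffOn ℂ (1 + 1) Dfun {Y : PBond P 0 → Matrix n n ℂ | ∀ b, w 1 b * ‖Y b‖ < ε} := h.of_le le_top
  exact ((contDiffOn_succ_iff_fderiv_of_isOpen (isOpen_weightedBall w ε)).1 h2').2.2.differentiableOn one_ne_zero

end Solution

/-! ## §3  ★★ The analytic selector edition of [15] Prop. 3 for the true constraint -/

/-- ★★ **[15] PROP. 3 FOR THE TRUE MULTI-LEVEL CONSTRAINT, ANALYTIC EDITION**: under the binders of §2 there is a map `Dfun` which is `C^ω` on the weighted `ε`-ball and,
at every `A′` of the ball, obeys (55) `‖Dfun A′ i‖ ≤ 4C₂ρ²` (all size bounds `ρ`), (49) `C(A′ − H·Dfun A′) = Dfun A′` and (48) `chartLog η D (A′ − H·Dfun A′) = Qlin A′`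
— «the transformation (47) … linearizing the averaging operation … is defined and analytic … The function D(A′) satisfies the bound (55)» (p. 289).  The selector is
dag-n07-w2's `exists_chartD_of_rightInverse` pointwise; by `chartD_unique` it coincides on the ball with every solution family of (49) obeying (55), in particular with
`N07ChartDDerivative`'s `Dfun` (which carries (73)). [cite: Balaban1985Variational, (47)-(50) p.285, (55) p.286, Prop. 3 p.289, (157) p.302] -/
theorem exists_analytic_chartD_of_rightInverse (k : ℕ) {R' M : ℕ} (hR'L : 2 * P.L ≤ R') (hM : 1 ≤ M) (D : Domains P) (hDk : D.k = k)
    (hAdm : Adm22 D R' M) {w : ℕ → PBond P 0 → ℝ} (hw : IsLevWeight P k D w)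
    (H : (BondIdx D → Matrix n n ℂ) →ₗ[ℂ] (PBond P 0 → Matrix n n ℂ))
    (hHinv : ∀ X, (fderiv ℂ (chartLog (((P.L : ℝ)⁻¹) ^ k) D : (PBond P 0 → Matrix n n ℂ) → BondIdx D → Matrix n n ℂ) 0) (H X) = X)
    {B₀ : ℝ} (hB₀ : 0 ≤ B₀)
    (hHB : ∀ (X : BondIdx D → Matrix n n ℂ) (t : ℝ), 0 ≤ t → (∀ i, ‖X i‖ ≤ t) → ∀ b, w 1 b * ‖H X b‖ ≤ B₀ * t)
    {ε : ℝ} (hε : 0 < ε)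
    (h18 : 18 * (960 * (((P.d + 2) * P.L : ℕ) : ℝ) * (P.L : ℝ) / (12800 * (((P.d + 2) * P.L : ℕ) : ℝ) ^ 2 * (P.L : ℝ))⁻¹) * B₀ * ε ≤ 1)
    (h2 : 64 * ε ≤ (12800 * (((P.d + 2) * P.L : ℕ) : ℝ) ^ 2 * (P.L : ℝ))⁻¹) :
    let η : ℝ := ((P.L : ℝ)⁻¹) ^ k
    let C₂ : ℝ := 960 * (((P.d + 2) * P.L : ℕ) : ℝ) * (P.L : ℝ) / (12800 * (((P.d + 2) * P.L : ℕ) : ℝ) ^ 2 * (P.L : ℝ))⁻¹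
    let Qlin := (fderiv ℂ (chartLog η D : (PBond P 0 → Matrix n n ℂ) → BondIdx D → Matrix n n ℂ) 0)
    ∃ Dfun : (PBond P 0 → Matrix n n ℂ) → (BondIdx D → Matrix n n ℂ),
      ContDiffOn ℂ ω Dfun {Y : PBond P 0 → Matrix n n ℂ | ∀ b, w 1 b * ‖Y b‖ < ε} ∧
      DifferentiableOn ℂ (fderiv ℂ Dfun) {Y : PBond P 0 → Matrix n n ℂ | ∀ b, w 1 b * ‖Y b‖ < ε} ∧
      ∀ A' : PBond P 0 → Matrix n n ℂ, (∀ b, w 1 b * ‖A' b‖ < ε) →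
        (∀ ρ : ℝ, 0 ≤ ρ → (∀ b, w 1 b * ‖A' b‖ ≤ ρ) → ∀ i, ‖Dfun A' i‖ ≤ 4 * C₂ * ρ ^ 2) ∧
        chartLog η D (A' - H (Dfun A')) - Qlin (A' - H (Dfun A')) = Dfun A' ∧
        chartLog η D (A' - H (Dfun A')) = Qlin A' ∧
        HasFDerivAt Dfun (fderiv ℂ Dfun A') A' := by
  intro η C₂ Qlin
  classical
  have hL0 : (0 : ℝ) < P.L := by exact_mod_cast P.L_pos
  have hℓ1 : (1 : ℝ) ≤ (((P.d + 2) * P.L : ℕ) : ℝ) := by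
    exact_mod_cast Nat.one_le_iff_ne_zero.mpr (Nat.mul_ne_zero (by omega) (by have := P.hL.2; omega))
  have hC₂ : 0 ≤ C₂ := by
    show 0 ≤ 960 * (((P.d + 2) * P.L : ℕ) : ℝ) * (P.L : ℝ) / (12800 * (((P.d + 2) * P.L : ℕ) : ℝ) ^ 2 * (P.L : ℝ))⁻¹
    positivity
  obtain ⟨hq, h3⟩ := window_of_h18 hC₂ hB₀ hε h18 h2
  -- the pointwise selector
  have hpt := fun (A' : PBond P 0 → Matrix n n ℂ) (hA' : ∀ b, w 1 b * ‖A' b‖ < ε) =>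
    exists_chartD_of_rightInverse (n := n) k hR'L hM D hDk hAdm hw H hHinv hB₀ hHB hε hq h3 A' hA'
  let Dfun : (PBond P 0 → Matrix n n ℂ) → (BondIdx D → Matrix n n ℂ) := fun A' =>
    if hA' : (∀ b, w 1 b * ‖A' b‖ < ε) then Classical.choose (hpt A' hA') else 0
  have hDfun : ∀ (A' : PBond P 0 → Matrix n n ℂ) (hA' : ∀ b, w 1 b * ‖A' b‖ < ε), Dfun A' = Classical.choose (hpt A' hA') :=
    fun A' hA' => dif_pos hA'
  have h55 : ∀ A' : PBond P 0 → Matrix n n ℂ, (∀ b, w 1 b * ‖A' b‖ < ε) →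
      ∀ ρ : ℝ, 0 ≤ ρ → (∀ b, w 1 b * ‖A' b‖ ≤ ρ) → ∀ i, ‖Dfun A' i‖ ≤ 4 * C₂ * ρ ^ 2 := fun A' hA' => by
    rw [hDfun A' hA']; exact (Classical.choose_spec (hpt A' hA')).2.2.1
  have h49 : ∀ A' : PBond P 0 → Matrix n n ℂ, (∀ b, w 1 b * ‖A' b‖ < ε) →
      chartLog η D (A' - H (Dfun A')) - Qlin (A' - H (Dfun A')) = Dfun A' := fun A' hA' => by
    rw [hDfun A' hA']; exact (Classical.choose_spec (hpt A' hA')).1.2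
  have h48 : ∀ A' : PBond P 0 → Matrix n n ℂ, (∀ b, w 1 b * ‖A' b‖ < ε) →
      chartLog η D (A' - H (Dfun A')) = Qlin A' := fun A' hA' => by
    rw [hDfun A' hA']; exact (Classical.choose_spec (hpt A' hA')).2.2.2
  refine ⟨Dfun, contDiffOn_chartD k hR'L hM D hDk hAdm hw H hHinv hB₀ hHB hε h18 h2 Dfun h55 h49,
    differentiableOn_fderiv_chartD k hR'L hM D hDk hAdm hw H hHinv hB₀ hHB hε h18 h2 Dfun h55 h49, fun A' hA' => ?_⟩
  exact ⟨h55 A' hA', h49 A' hA', h48 A' hA', hasFDerivAt_chartD k hR'L hM D hDk hAdm hw H hHinv hB₀ hHB hε h18 h2 Dfun h55 h49 A' hA'⟩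

end Summit.QuantumFields.YangMills.Theorems.K0Stub1ChartDAnalytic

end
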